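import Summits.QuantumAdvantage.AdviceFreeQNC0.WalkHardFLinFormsSqrt
import HarnessLib

/-!
# Route OddPrimeWalk, support item `LinFormsSqrtOdd` (stmt-QuantumAdvantage-27290, rung R11″): rank-`√n` linear forms with
# arbitrary tables lose the u-walk game, every prime `p ≥ 5`

The item `LinFormsSqrtOdd` (planner qa-qnc0-p2 g20, ROUND-20 (p2) §3) — for every prime `p ≥ 5` there are `θ < 1`, `κ > 0` such
that for all large `n` a strategy reading `u` only through `K` linear forms mod `p` with `K² ≤ κ·n`, with ARBITRARY tables per cut,
wins `ringWinU c` on at most `θ·2ⁿ` inputs — is the tree theorem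
`Summit.QuantumAdvantage.AdviceFreeQNC0.walkHardFLinFormsSqrt (p) (hp3 : p ≠ 3)` (`AdviceFreeQNC0/WalkHardFLinFormsSqrt.lean`:
`LinForms.card_win_le` + `exists_regular_span` + the hidden-coins bound `hiddenCoinsFour`, `θ = 7/8`) at `p ≥ 5`; the item's body
and `WalkHardFLinFormsSqrt p` agree verbatim.
WHAT THIS IS NOT: the rank-`n` dense residual (R5 / cruxes 23109, 23029; the `p^K` wall (W2)) is untouched; separation NOT moved.
-/

set_option linter.dupNamespace false

namespace Summit.QuantumAdvantage.QuantumAdvantage.Theorems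

/-- **Item `LinFormsSqrtOdd` (R11″) — PROVED**: `∀ p ≥ 5 prime, WalkHardFLinFormsSqrt p` (signature verbatim; one line over
`AdviceFreeQNC0.walkHardFLinFormsSqrt`). -/
theorem oddPrimeWalk_linFormsSqrtOdd : ∀ (p : ℕ) [Fact p.Prime], 5 ≤ p → ∃ θ : ℝ, θ < 1 ∧ ∃ κ : ℝ, 0 < κ ∧ ∃ n₀ : ℕ, ∀ n ≥ n₀, ∀ c K : ℕ, (K : ℝ) ^ 2 ≤ κ * n → ∀ lam : Fin K → Fin n → ZMod p, ∀ tab : Fin (n + 1) → (Fin K → ZMod p) → Bool, ((Finset.univ.filter fun u : Fin n → Bool => Summit.QuantumAdvantage.AdviceFreeQNC0.ringWinU c (fun g v => tab g (fun j => Finset.univ.sum fun i : Fin n => if v i then lam j i else 0)) u = true).card : ℝ) ≤ θ * (2 : ℝ) ^ n :=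
  fun p _ hp => Summit.QuantumAdvantage.AdviceFreeQNC0.walkHardFLinFormsSqrt p (by omega)

end Summit.QuantumAdvantage.QuantumAdvantage.Theorems
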